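import Summits.ResolutionOfSingularities.ResolutionOfSingularities.Theorems.FrobeniusClosingPatchingRelPerfectDepthSNCExchange
import Literature.AlgebraicGeometry.Resolution.RegularLocalRingsQuotient
import Literature.AlgebraicGeometry.Resolution.RsopMonomialIdeals
import Literature.AlgebraicGeometry.Resolution.MonomialMarkedIdeals
import Literature.AlgebraicGeometry.Resolution.BoundarySplitting
import Literature.AlgebraicGeometry.Resolution.MarkedIdealsLemmas
import Literature.AlgebraicGeometry.Resolution.PrimeDivisorIdeals
import Literature.AlgebraicGeometry.Resolution.StrictNormalCrossingsFlatDescent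
import HarnessLib

/-!
# Crux `PatchingRelPerfect` (stmt-ResolutionOfSingularities-16161), chain W5.2 — TargetsF5J T5-E
# «W₂B-maxweight»: producing the JOINT clause at a centre point

[OURS · L1 W5.2 · TargetsF5J T5-E support] Fact-free; NOT statements of the manuscript under review. The JOINT clause of
`IsWeightedSeqJ.cons` (plan-1 F5J; res-D-pv-009 07:39:08Z (A)) asks, at a required centre point `z`, for simple normal
crossings AT `z` of the host together with the N-charged and the D-charged boundary members, compatibly with the centre:
`SNCWithAt (𝓗 :: 𝒦) C z`. This file produces it from the transported data of the E-side state, in the two cases of the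
proof of T5-E, over res-type-049's exchange lemma (`SNCWithAt.cons_of_stalkIdeal_le` / `host_cons_transversal`,
`…DepthSNCExchange`, brick (L-C)):

* `sncWithAt_singleton_of_not_mem_sq` — a host `𝓗` principal at `z` with generator `h ∈ 𝔪_z ∖ 𝔪_z²` in a regular local
  ring is snc at `z` as a one-member family (`SNCWithAt [𝓗] ⊤ z`; Matsumura 14.2: extend `h` to a regular system of
  parameters);
* `sncWithAt_host_cons_of_tracked` — CASE A (the point lies on an N-charged member): the invariant «host :: tracked members
  snc at `z`» + «boundary snc with the centre at `z`» (res-type-019's P3 read pointwise) + «host contains the centre» give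
  `SNCWithAt (𝓗 :: 𝒦) C z` for the tracked list `𝒦 ⊆ ℬ`;
* `not_stalkIdeal_le_centre_of_charged` — at a WEIGHT-ONE piece (`ord_η 𝔟 ≤ 1` at the generic point `η`, host through
  `η`), every positively-charged boundary member through `z` is TRANSVERSAL to the centre at `z` (`B_z ⊄ C_z`: else
  `η ∈ V(B)` and `ord_η 𝔟 ≥ 2`);
* `sncWithAt_host_cons_of_weightOne` — CASE B (weight-one piece, no N-charged member through `z`): the regular host
  (P4, `exists_regular_host_generator`) + P3 pointwise + transversality give `SNCWithAt (𝓗 :: 𝒦) C z`.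

AI-written; AI review is weaker than expert review.

## References
* J. Kollár, *Lectures on Resolution of Singularities* (2007), 3.104 Step 2.1, Def. 3.24. [Kollar2007]
* H. Matsumura, *Commutative Ring Theory* (1986), Thm. 14.2. [Matsumura1987]
* E. Bierstone, D. Grigoriev, P. Milman, J. Włodarczyk, arXiv:1206.3090, Def. 3.1.3 (2). [BierstoneGrigorievMilmanWlodarczyk2011]
-/

-- `Summit.<Summit>.<Sub>.Theorems` with `Sub = Summit` (single-conjunct summit, D-0017)
set_option linter.dupNamespace false

noncomputable section

open CategoryTheory CategoryTheory.Limits AlgebraicGeometry TopologicalSpace IsLocalRing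
open Literature.AlgebraicGeometry.Resolution Scheme.IdealSheafData

namespace Summit.ResolutionOfSingularities.ResolutionOfSingularities.Theorems

universe u

namespace WeightTwoB

open DepthSNC

variable {X : Scheme.{u}}

/-! ## §1 A principal order-one host is snc at the point -/

/-- **A principal host of order one is a one-member snc family at the point**: if `𝒪_{X,z}` is regular, `𝓗_z = (h)` with
`h ∈ 𝔪_z ∖ 𝔪_z²`, then `SNCWithAt [𝓗] ⊤ z` (extend `h` to a regular system of parameters). [cite: Matsumura1987, Thm. 14.2] -/
theorem sncWithAt_singleton_of_not_mem_sq {𝓗 : X.IdealSheafData} {z : X} [IsRegularLocalRing (X.presheaf.stalk z)]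
    {h : X.presheaf.stalk z} (h𝓗z : stalkIdeal 𝓗 z = Ideal.span {h}) (hh : h ∈ maximalIdeal (X.presheaf.stalk z))
    (hh2 : h ∉ maximalIdeal (X.presheaf.stalk z) ^ 2) : SNCWithAt [𝓗] ⊤ z := by
  -- `h` is part of a regular system of parameters
  let c : Fin 1 → X.presheaf.stalk z := fun _ => h
  have hrange : Set.range c = {h} := by
    ext a
    simp only [Set.mem_range, Set.mem_singleton_iff, Fin.exists_fin_one, c, eq_comm]
  have hq := IsRegularLocalRing.quotient_span_singleton hh hh2
  have hc : IsRsopPart c := by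
    haveI : IsRegularLocalRing (X.presheaf.stalk z ⧸ Ideal.span (Set.range c)) := by rw [hrange]; exact hq.1
    refine IsRsopPart.of_isRegularLocalRing_quotient (fun _ => hh) (le_of_eq ?_)
    rw [hrange, Nat.cast_one]
    exact hq.2
  obtain ⟨e, x, hsf, hspan, hx⟩ := hc.exists_rsop
  refine ⟨inferInstance, 1 + e, x, hsf, hspan, ⟨fun _ => Fin.castAdd e 0, ?_, ?_⟩, fun hz => ?_⟩
  · intro D₁ D₂ _
    have h1 : D₁.1 = 𝓗 := List.mem_singleton.mp D₁.2.1
    have h2 : D₂.1 = 𝓗 := List.mem_singleton.mp D₂.2.1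
    exact Subtype.ext (h1.trans h2.symm)
  · intro D
    have h1 : D.1 = 𝓗 := List.mem_singleton.mp D.2.1
    rw [h1, h𝓗z, hx 0]
  · rw [Scheme.IdealSheafData.support_top] at hz
    exact absurd hz id

/-! ## §2 Case A: the point lies on a tracked (N-charged) member -/

/-- **CASE A of the JOINT clause** (the centre point lies on an N-charged member, where the transport invariant «host ::
tracked members snc at the point» is available): `SNCWithAt ℬ C z` (boundary snc with the centre at `z`),
`SNCWithAt (𝓗 :: 𝒦) ⊤ z` (invariant), `𝓗_z ⊆ C_z` (host contains the centre) and `𝒦 ⊆ ℬ` give `SNCWithAt (𝓗 :: 𝒦) C z`.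
[cite: Kollar2007, 3.104 Step 2.1] -/
theorem sncWithAt_host_cons_of_tracked {ℬ 𝒦 : List X.IdealSheafData} {C 𝓗 : X.IdealSheafData} {z : X}
    (hℬ : SNCWithAt ℬ C z) (hJ : SNCWithAt (𝓗 :: 𝒦) ⊤ z) (h𝓗C : stalkIdeal 𝓗 z ≤ stalkIdeal C z)
    (h𝒦 : ∀ B ∈ 𝒦, B ∈ ℬ) : SNCWithAt (𝓗 :: 𝒦) C z :=
  SNCWithAt.cons_of_stalkIdeal_le hℬ hJ h𝓗C fun B hB _ => ⟨h𝒦 B hB, Or.inl hB⟩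

/-! ## §3 Case B: a weight-one piece -/

/-- **Positively charged members are transversal to a weight-one centre.** Let `η ⤳ z` with `C_z = 𝔭_η` (the centre
piece through `z` is `cl{η}`), `𝔟 = 𝓗 · monomialIdeal E` with `η ∈ Supp 𝓗` and `ord_η 𝔟 ≤ 1`. Then every member `B`
of exponent `c > 0` in `E` is transversal to the centre at `z`: `B_z ⊄ C_z` (otherwise `η ∈ V(B)` and
`𝔟_η ⊆ 𝓗_η · B_η ⊆ 𝔪_η²`). [folklore] -/
theorem not_stalkIdeal_le_centre_of_charged {𝔟 𝓗 C : X.IdealSheafData} {E : List (X.IdealSheafData × ℕ)}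
    {η z : X} (hηz : η ⤳ z) (hCz : stalkIdeal C z = primeOfSpecializes hηz) (h𝔟 : 𝔟 = 𝓗 * monomialIdeal E)
    (hηH : η ∈ 𝓗.support) (hord : idealOrder 𝔟 η ≤ 1) {B : X.IdealSheafData} {c : ℕ} (hBc : (B, c) ∈ E)
    (hc : 0 < c) : ¬ stalkIdeal B z ≤ stalkIdeal C z := by
  intro hle
  -- `η ∈ V(B)`
  have hBη : stalkIdeal B η ≤ maximalIdeal (X.presheaf.stalk η) := by
    rw [← stalkIdeal_map_stalkSpecializes B hηz]
    refine (Ideal.map_mono hle).trans ?_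
    rw [hCz]
    exact Ideal.map_comap_le
  -- `𝔟_η ⊆ 𝔪_η²`
  have hM : stalkIdeal (monomialIdeal E) η ≤ maximalIdeal (X.presheaf.stalk η) := by
    have h1 : monomialIdeal E ≤ B ^ c := by
      have := IdealSheafData.prod_le_of_mem (L := E.map fun p => p.1 ^ p.2) (J := B ^ c)
        (List.mem_map.mpr ⟨(B, c), hBc, rfl⟩)
      exact this
    refine (stalkIdeal_mono h1 η).trans ?_
    rw [stalkIdeal_pow]
    exact (Ideal.pow_le_self hc.ne').trans hBη
  have h2 : stalkIdeal 𝔟 η ≤ maximalIdeal (X.presheaf.stalk η) ^ 2 := by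
    rw [h𝔟, stalkIdeal_mul, pow_two]
    exact Ideal.mul_mono ((mem_support_iff_stalkIdeal_le 𝓗 η).mp hηH) hM
  have h3 : (2 : ℕ∞) ≤ idealOrder 𝔟 η := (le_idealOrder_iff 𝔟 η 2).mpr h2
  exact absurd (h3.trans hord) (by decide)

/-- **CASE B of the JOINT clause (weight-one piece, no N-charged member through the point).** At `z ∈ cl{η} = V(C)`
near `z` with `C_z = 𝔭_η`, a host principal at `z` with generator `h ∈ C_z ∖ 𝔪_z²` (the regular host of P4,
`exists_regular_host_generator`), `SNCWithAt ℬ C z`, `𝔟 = 𝓗 · monomialIdeal E` with `ord_η 𝔟 ≤ 1` and `η ∈ Supp 𝓗`: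
for every list `𝒦` whose members through `z` are positively charged members of `E` (and belong to `ℬ`),
`SNCWithAt (𝓗 :: 𝒦) C z`. [cite: Kollar2007, 3.104 Step 2.1] [cite: Matsumura1987, Thm. 14.2] -/
theorem sncWithAt_host_cons_of_weightOne {𝔟 𝓗 C : X.IdealSheafData} {ℬ 𝒦 : List X.IdealSheafData}
    {E : List (X.IdealSheafData × ℕ)} {η z : X} [IsRegularLocalRing (X.presheaf.stalk z)] (hηz : η ⤳ z)
    (hCz : stalkIdeal C z = primeOfSpecializes hηz) (hℬ : SNCWithAt ℬ C z)
    {h : X.presheaf.stalk z} (h𝓗z : stalkIdeal 𝓗 z = Ideal.span {h}) (hhC : h ∈ stalkIdeal C z)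
    (hh2 : h ∉ maximalIdeal (X.presheaf.stalk z) ^ 2)
    (h𝔟 : 𝔟 = 𝓗 * monomialIdeal E) (hηH : η ∈ 𝓗.support) (hord : idealOrder 𝔟 η ≤ 1)
    (h𝒦 : ∀ B ∈ 𝒦, z ∈ B.support → B ∈ ℬ ∧ ∃ c, 0 < c ∧ (B, c) ∈ E) :
    SNCWithAt (𝓗 :: 𝒦) C z := by
  haveI : (primeOfSpecializes hηz).IsPrime := Ideal.IsPrime.comap _
  have hh : h ∈ maximalIdeal (X.presheaf.stalk z) := by
    have hCne : stalkIdeal C z ≠ ⊤ := by rw [hCz]; exact Ideal.IsPrime.ne_top ‹_›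
    exact le_maximalIdeal hCne hhC
  have h1 : SNCWithAt [𝓗] ⊤ z := sncWithAt_singleton_of_not_mem_sq h𝓗z hh hh2
  have h𝓗C : stalkIdeal 𝓗 z ≤ stalkIdeal C z := by
    rw [h𝓗z, Ideal.span_singleton_le_iff_mem]
    exact hhC
  refine SNCWithAt.host_cons_transversal hℬ h1 h𝓗C fun B hB hzB => ?_
  obtain ⟨hBℬ, c, hc, hBc⟩ := h𝒦 B hB hzB
  exact ⟨hBℬ, not_stalkIdeal_le_centre_of_charged hηz hCz h𝔟 hηH hord hBc hc⟩

end WeightTwoB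

end Summit.ResolutionOfSingularities.ResolutionOfSingularities.Theorems

end
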